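import Literature.Probability.Percolation.CornerPercolation
import Literature.Probability.Percolation.SiteConnectionTools
import Literature.Probability.RandomPlanarGeometry.ChordalCurveFamily
import Literature.Probability.LatticeModels.IsoradialGraphsProofs

/-!
# Stub `stub_bondCrude_quarterTurn` of the line `CardySelfDualSegmentQuarterTurnPinning`
# (crux `QuarterTurnPinning`, stmt-CriticalPhenomena-5475, route `CardySelfDualSegment`)

The finite-`δ` quarter-turn identity of the crude bond-`ℤ²` crossing probability: for every
conformal rectangle `R` and every mesh `δ`, the `P_{1/2}`-probability of the crude crossing event
`embDomainCrossing squareLatticeEmbedding.z` of the quarter-turned rectangle `i · R` (carrier,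
arcs and marked points multiplied by `i`) equals that of `R`.

Proof. The lattice rotation `ρ : (x₀, x₁) ↦ (-x₁, x₀)` is the signed coordinate permutation
`zdSignedPermIso (Equiv.swap 0 1) ![-1, 1]`, an automorphism of the square lattice, and the
embedding `z = √2 · toComplex` intertwines it with multiplication by `i`
(`squareLatticeEmbedding_z_rot`). Since `w ↦ i w` is an isometry (`Metric.infDist_image`), the
vertex set `{y | δ z y ∈ i Ω}` and the two `2δ`-neighbourhoods `{u | infDist (δ z u) (i A) ≤ 2δ}`
of the crude event are the `ρ`-images of those for `(Ω; A, B)`, so the event of `i · R` is the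
transported open crossing event, which has the same probability (`bondPercolation_real_image`).
Elementary; no literature fact is used (Grimmett 1999 §1.6, invariance of `P_p` under lattice
symmetries).
-/

noncomputable section

open Set Complex MeasureTheory
open Literature.Probability.RandomPlanarGeometry
open Literature.Probability.Percolation
open Literature.Probability.LatticeModels

namespace Summit.CriticalPhenomena.CardyFormulaZ2.Theorems

namespace CardySelfDualSegmentQuarterTurnPinning

/-- The square-lattice embedding intertwines the lattice rotation `(x₀, x₁) ↦ (-x₁, x₀)`
(`zdSignedPermIso (Equiv.swap 0 1) ![-1, 1]`) with multiplication by `i`. -/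
theorem squareLatticeEmbedding_z_rot (x : Site 2) :
    squareLatticeEmbedding.z (zdSignedPermIso (Equiv.swap 0 1) ![-1, 1] x) =
      I * squareLatticeEmbedding.z x := by
  rw [squareLatticeEmbedding_z, squareLatticeEmbedding_z]
  apply Complex.ext
  · simp [Equiv.swap_apply_left]
  · simp [Equiv.swap_apply_right]

/-- The inverse rotation is intertwined with multiplication by `-i`. -/
theorem squareLatticeEmbedding_z_rot_symm (y : Site 2) :
    squareLatticeEmbedding.z ((zdSignedPermIso (Equiv.swap 0 1) ![-1, 1]).symm y) =
      -I * squareLatticeEmbedding.z y := by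
  have h := squareLatticeEmbedding_z_rot ((zdSignedPermIso (Equiv.swap 0 1) ![-1, 1]).symm y)
  rw [RelIso.apply_symm_apply] at h
  rw [← mul_right_inj' I_ne_zero, ← mul_assoc, ← h, mul_neg, I_mul_I, neg_neg, one_mul]

/-- Multiplication by `i` is an isometry of `ℂ`. -/
theorem isometry_mul_I : Isometry fun z : ℂ => I * z :=
  Isometry.of_dist_eq fun x y => by
    rw [Complex.dist_eq, Complex.dist_eq, ← mul_sub, norm_mul, Complex.norm_I, one_mul]

/-- The vertices whose rescaled position lies in `i Ω` are the rotated vertices for `Ω`. -/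
theorem setOf_mem_mulI_image (Ω : Set ℂ) (δ : ℝ) :
    {y : Site 2 | (δ : ℂ) * squareLatticeEmbedding.z y ∈ (Homeomorph.mulLeft₀ I I_ne_zero) '' Ω} =
      zdSignedPermIso (Equiv.swap 0 1) ![-1, 1] ''
        {y : Site 2 | (δ : ℂ) * squareLatticeEmbedding.z y ∈ Ω} := by
  ext y
  rw [show (⇑(zdSignedPermIso (Equiv.swap 0 1) ![-1, 1]) : Site 2 → Site 2) =
      ⇑(zdSignedPermIso (Equiv.swap 0 1) ![-1, 1]).toEquiv from rfl, Equiv.image_eq_preimage_symm,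
    Homeomorph.image_eq_preimage_symm]
  simp only [mem_setOf_eq, mem_preimage, Homeomorph.mulLeft₀_symm_apply]
  rw [show ((zdSignedPermIso (Equiv.swap 0 1) ![-1, 1]).toEquiv.symm y) =
      (zdSignedPermIso (Equiv.swap 0 1) ![-1, 1]).symm y from rfl, squareLatticeEmbedding_z_rot_symm,
    show I⁻¹ * ((δ : ℂ) * squareLatticeEmbedding.z y) = (δ : ℂ) * (-I * squareLatticeEmbedding.z y) by
      rw [Complex.inv_I]; ring]

/-- The vertices within rescaled distance `2δ` of `i A` are the rotated vertices for `A`. -/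
theorem setOf_infDist_mulI_image (A : Set ℂ) (δ : ℝ) :
    {u : Site 2 | Metric.infDist ((δ : ℂ) * squareLatticeEmbedding.z u)
        ((Homeomorph.mulLeft₀ I I_ne_zero) '' A) ≤ 2 * δ} =
      zdSignedPermIso (Equiv.swap 0 1) ![-1, 1] ''
        {u : Site 2 | Metric.infDist ((δ : ℂ) * squareLatticeEmbedding.z u) A ≤ 2 * δ} := by
  ext u
  rw [show (⇑(zdSignedPermIso (Equiv.swap 0 1) ![-1, 1]) : Site 2 → Site 2) =
      ⇑(zdSignedPermIso (Equiv.swap 0 1) ![-1, 1]).toEquiv from rfl, Equiv.image_eq_preimage_symm]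
  simp only [mem_setOf_eq, mem_preimage, Homeomorph.coe_mulLeft₀]
  have h : (δ : ℂ) * squareLatticeEmbedding.z u =
      I * ((δ : ℂ) * squareLatticeEmbedding.z
        ((zdSignedPermIso (Equiv.swap 0 1) ![-1, 1]).toEquiv.symm u)) := by
    rw [show ((zdSignedPermIso (Equiv.swap 0 1) ![-1, 1]).toEquiv.symm u) =
      (zdSignedPermIso (Equiv.swap 0 1) ![-1, 1]).symm u from rfl, squareLatticeEmbedding_z_rot_symm]
    linear_combination ((δ : ℂ) * squareLatticeEmbedding.z u) * Complex.I_sq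
  rw [h, Metric.infDist_image isometry_mul_I]

/-- The crude crossing event of `(i Ω; i A, i B)` has the same `P_{1/2}`-probability as that of
`(Ω; A, B)`. -/
theorem bond_real_embDomainCrossing_mulI (Ω A B : Set ℂ) (δ : ℝ) :
    (bondPercolation (zdGraph 2) half).real
        (embDomainCrossing squareLatticeEmbedding.z ((Homeomorph.mulLeft₀ I I_ne_zero) '' Ω) δ
          ((Homeomorph.mulLeft₀ I I_ne_zero) '' A) ((Homeomorph.mulLeft₀ I I_ne_zero) '' B)) =
      (bondPercolation (zdGraph 2) half).real
        (embDomainCrossing squareLatticeEmbedding.z Ω δ A B) := by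
  unfold embDomainCrossing
  rw [setOf_mem_mulI_image, setOf_infDist_mulI_image, setOf_infDist_mulI_image]
  exact bondPercolation_real_image (zdSignedPermIso (Equiv.swap 0 1) ![-1, 1]) half _ _ _

end CardySelfDualSegmentQuarterTurnPinning

open CardySelfDualSegmentQuarterTurnPinning

/-- **Stub `stub_bondCrude_quarterTurn`** (finite quarter-turn identity): the crude bond-`ℤ²`
crossing probability at `p = 1/2` of the quarter-turned conformal rectangle `i · R` equals that of
`R`, for every mesh `δ` (rotation invariance of `P_{1/2}` on `ℤ²`, transported through the
embedding `squareLatticeEmbedding.z` and the isometry `w ↦ i w`). -/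
theorem stub_bondCrude_quarterTurn (R : ConformalRectangle) (δ : ℝ) :
    (bondPercolation (zdGraph 2) half).real
        (embDomainCrossing squareLatticeEmbedding.z
          (R.map (Homeomorph.mulLeft₀ I I_ne_zero)).carrier δ
          ((R.map (Homeomorph.mulLeft₀ I I_ne_zero)).arc 0)
          ((R.map (Homeomorph.mulLeft₀ I I_ne_zero)).arc 2)) =
      (bondPercolation (zdGraph 2) half).real
        (embDomainCrossing squareLatticeEmbedding.z R.carrier δ (R.arc 0) (R.arc 2)) := by
  rw [MarkedDomain.carrier_map, MarkedDomain.arc_map, MarkedDomain.arc_map]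
  exact bond_real_embDomainCrossing_mulI R.carrier (R.arc 0) (R.arc 2) δ

end Summit.CriticalPhenomena.CardyFormulaZ2.Theorems

end
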